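import Mathlib
import HarnessLib
import Summits.Ventures.LatticeQCDFlow.Scaling.IdentityFlowAcceptanceDiagonalLimit
import Summits.Ventures.LatticeQCDFlow.Scaling.CumulantDiagonalSubexponential

/-!
# LatticeQCDFlow / Scaling — the diagonal acceptance law `acc_n(c/√n) → erfc(|c|σ/2)` for
# UNBOUNDED block statistics with exponential moments near the origin

HONEST FRAMING: exact (Metropolis-corrected) sampling algorithms for lattice gauge theory;
figures of merit are autocorrelation/cost numbers at stated couplings and volumes; no
continuum-physics claim.

Venture `LatticeQCDFlow` (cell pub-lqcd), topic `Scaling`; FANOUT row 3 (`s0-u1-a`, S0-B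
implementation A, GEN-20).  NEW WORK of the cell — the proof of row 3's GEN-19
`Scaling/IdentityFlowAcceptanceDiagonalLimit` (imported for its plumbing: product laws, the pair
functional, the row partition function, the CLT for product rows) re-run WITHOUT the boundedness of the
block statistic, using `Scaling/CumulantDiagonalSubexponential` (`M(t/√n)^n → e^{t²σ²/2}` under
exponential moments near `0`) in place of Hoeffding's lemma: the uniform second-moment bound on the pair
functional holds EVENTUALLY, which is enough after a shift of the sequence; NO definition is
introduced; nothing is cited.

## Statement (all `[ours]`)

Block law `ν`, measurable CENTRED statistic `g` with `0 ∈ interior(integrableExpSet g ν)` (all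
exponential moments `E e^{tg}` finite for `|t|` small: sub-exponential tails; e.g. polynomial
statistics of Gaussian or `φ⁴` blocks), `σ² = Var g`; proposal `ν^{⊗n}`, target `e^{βT}ν^{⊗n}/M(β)^n`,
`T = Σᵢ g(xᵢ)`, `β = c/√n`:
* `pi_integrable_exp_mul_sum` — `e^{tT} ∈ L¹(ν^{⊗n})` whenever `e^{tg} ∈ L¹(ν)`;
* **`tiltPi_meanAccept_diag_tendsto_of_mem_interior`** — `acc_n(c/√n) →
  ∫∫ min(e^x, e^y) dN(−s/2, s)²`, `s = c²σ²`;
* **`tiltPi_meanAccept_diag_tendsto_erfc_of_mem_interior`** — `= erfc(|c|σ/2)` (`c ≠ 0`, `σ² ≠ 0`).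

NOT CLAIMED: general coupling sequences / the loss dictionary for unbounded statistics (the
monotonicity file assumes exponential moments at the couplings compared — available here — but the
inversion lemmas use boundedness); rates; any value at the cell's `(β, L)`; nothing re-scored.
-/

noncomputable section

namespace Summit.Ventures.LatticeQCDFlow.Theory2

open MeasureTheory ProbabilityTheory Filter Finset Real Set
open scoped Topology NNReal

section Subexp

open Literature.Probability.Distributions.PseudoMarginalNoise

variable {X : Type*} {mX : MeasurableSpace X} {ν : Measure X} [IsProbabilityMeasure ν] {g : X → ℝ}

/-- `e^{tΣᵢg(xᵢ)} = ∏ᵢ e^{t g(xᵢ)}` is integrable on `ν^{⊗n}` when `e^{tg} ∈ L¹(ν)`. [ours] -/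
theorem pi_integrable_exp_mul_sum (n : ℕ) {t : ℝ} (ht : Integrable (fun x => Real.exp (t * g x)) ν) :
    Integrable (fun y : Fin n → X => Real.exp (t * ∑ i, g (y i))) (Measure.pi fun _ : Fin n => ν) := by
  have h := Integrable.fintype_prod (ι := Fin n) (f := fun _ : Fin n => fun x : X => Real.exp (t * g x))
    (μ := fun _ : Fin n => ν) (fun _ => ht)
  refine h.congr (ae_of_all _ fun y => ?_)
  simp only
  rw [Finset.mul_sum, Real.exp_sum]

/-- **THE DIAGONAL ACCEPTANCE LAW FOR UNBOUNDED STATISTICS.**  Centred measurable `g` with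
`0 ∈ interior(integrableExpSet g ν)`: the equilibrium acceptance of the untrained `n`-block sampler at
`β = c/√n` converges to the log-normal acceptance law `∫∫ min(e^x, e^y) dN(−s/2, s)²`, `s = c²·Var g`.
[ours] -/
theorem tiltPi_meanAccept_diag_tendsto_of_mem_interior (hgm : Measurable g)
    (h0int : (0 : ℝ) ∈ interior (integrableExpSet g ν)) (h0 : ∫ x, g x ∂ν = 0) (c : ℝ) :
    Tendsto (fun n : ℕ =>
        (∫ x, ∫ y, min (Real.exp (c / Real.sqrt n * ∑ i, g (x i)))
              (Real.exp (c / Real.sqrt n * ∑ i, g (y i)))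
            ∂(Measure.pi fun _ : Fin n => ν) ∂(Measure.pi fun _ : Fin n => ν))
          / ∫ x, Real.exp (c / Real.sqrt n * ∑ i, g (x i)) ∂(Measure.pi fun _ : Fin n => ν))
      atTop (𝓝 (∫ x, ∫ y, min (Real.exp x) (Real.exp y)
        ∂(noiseLaw (c ^ 2 * Var[g; ν]).toNNReal) ∂(noiseLaw (c ^ 2 * Var[g; ν]).toNNReal))) := by
  set v : ℝ := Var[g; ν] with hv
  have hv0 : 0 ≤ v := variance_nonneg _ _
  have hg2 : MemLp g 2 ν := memLp_of_mem_interior_integrableExpSet h0int 2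
  -- a ball inside the domain of the moment generating function
  obtain ⟨δ, hδ, hball⟩ := Metric.isOpen_iff.1 isOpen_interior 0 h0int
  have hdom : ∀ t : ℝ, |t| < δ → Integrable (fun x => Real.exp (t * g x)) ν := fun t ht =>
    interior_subset (s := integrableExpSet g ν) (hball (by rw [Metric.mem_ball, Real.dist_eq, sub_zero]; exact ht))
  -- the rows, their normalised sums and laws
  set P : (n : ℕ) → Measure (Fin n → X) := fun n => Measure.pi fun _ : Fin n => ν with hP
  set S : (n : ℕ) → (Fin n → X) → ℝ := fun n y => (Real.sqrt n)⁻¹ * ∑ i, g (y i) with hS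
  have hSm : ∀ n, Measurable (S n) := fun n =>
    (Finset.measurable_sum _ fun i _ => hgm.comp (measurable_pi_apply i)).const_mul _
  haveI hPn : ∀ n, IsProbabilityMeasure ((P n).map (S n)) := fun n =>
    Measure.isProbabilityMeasure_map (hSm n).aemeasurable
  set μs : ℕ → ProbabilityMeasure ℝ := fun n => ⟨(P n).map (S n), hPn n⟩ with hμs
  set μ : ProbabilityMeasure ℝ := ⟨gaussianReal 0 v.toNNReal, inferInstance⟩ with hμ
  -- (1) CLT for the rows (square integrability suffices)
  have hclt : Tendsto μs atTop (𝓝 μ) := by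
    have hZ : HasLaw (id : ℝ → ℝ) (gaussianReal 0 v.toNNReal) (gaussianReal 0 v.toNNReal) :=
      ⟨aemeasurable_id, Measure.map_id⟩
    have h := (pi_tendstoInDistribution_inv_sqrt_mul_sum (P' := gaussianReal 0 v.toNNReal)
      hg2 h0 hZ).tendsto
    simp only [Measure.map_id] at h
    convert h using 1
  -- (2) exponential moments of the laws, for `n` large: `|t|/√n < δ` for `t ∈ {c, 2c}`
  have hsmall : ∀ᶠ n : ℕ in atTop, |2 * c| / Real.sqrt n < δ ∧ 0 < n := by
    have ht : Tendsto (fun n : ℕ => |2 * c| / Real.sqrt n) atTop (𝓝 0) := by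
      have := (tendsto_inv_atTop_zero.comp
        (Real.tendsto_sqrt_atTop.comp tendsto_natCast_atTop_atTop)).const_mul (|2 * c|)
      simpa [div_eq_mul_inv] using this
    filter_upwards [(tendsto_order.1 ht).2 δ hδ, eventually_gt_atTop 0] with n h1 h2
    exact ⟨h1, h2⟩
  have hexpn : ∀ n : ℕ, |2 * c| / Real.sqrt n < δ → 0 < n → ∀ t : ℝ, |t| ≤ |2 * c| →
      Integrable (fun u => Real.exp (t * u)) ((μs n : Measure ℝ)) := by
    intro n hn hn0 t ht
    have hsn : 0 < Real.sqrt n := Real.sqrt_pos.2 (Nat.cast_pos.2 hn0)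
    have hdom' : Integrable (fun x => Real.exp (t / Real.sqrt n * g x)) ν := by
      refine hdom _ ?_
      rw [abs_div, abs_of_pos hsn]
      exact lt_of_le_of_lt (div_le_div_of_nonneg_right ht hsn.le) hn
    change Integrable (fun u => Real.exp (t * u)) ((P n).map (S n))
    rw [integrable_map_measure (by fun_prop) (hSm n).aemeasurable]
    refine (pi_integrable_exp_mul_sum n hdom').congr (ae_of_all _ fun y => ?_)
    simp only [Function.comp_apply, hS]
    congr 1
    ring
  have hexpG : ∀ t : ℝ, Integrable (fun u => Real.exp (t * u)) (μ : Measure ℝ) := fun t => by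
    change Integrable (fun u => Real.exp (t * id u)) (gaussianReal 0 v.toNNReal)
    exact (integrable_exp_mul_gaussianReal (μ := 0) (v := v.toNNReal) t)
  -- (3) the uniform second-moment bound, eventually: `M(2c/√n)^n → e^{2c²v}` so `≤ e^{2c²v} + 1`
  set C : ℝ := Real.exp ((2 * c) ^ 2 * v / 2) + 1 with hC
  have hden2 : Tendsto (fun n : ℕ => mgf g ν (2 * c / Real.sqrt n) ^ n) atTop
      (𝓝 (Real.exp ((2 * c) ^ 2 * v / 2))) :=
    tendsto_mgf_div_sqrt_pow_of_mem_interior h0int h0 (2 * c)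
  have hbound : ∀ᶠ n : ℕ in atTop, mgf g ν (2 * c / Real.sqrt n) ^ n ≤ C :=
    ((tendsto_order.1 hden2).2 C (by rw [hC]; linarith)).mono fun n hn => hn.le
  obtain ⟨N, hN⟩ := (hsmall.and hbound).exists_forall_of_atTop
  -- (4) the numerator along the shifted sequence `k ↦ k + N`
  have hnum : Tendsto (fun k => ∫ z, min (Real.exp (c * z.1)) (Real.exp (c * z.2))
        ∂(((μs (k + N) : Measure ℝ)).prod (μs (k + N)))) atTop
      (𝓝 (∫ z, min (Real.exp (c * z.1)) (Real.exp (c * z.2)) ∂((μ : Measure ℝ).prod μ))) := by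
    have hclt' : Tendsto (fun k => μs (k + N)) atTop (𝓝 μ) := hclt.comp (tendsto_add_atTop_nat N)
    have hc1 : |c| ≤ |2 * c| := by rw [abs_mul, abs_two]; linarith [abs_nonneg c]
    refine tendsto_integral_prod_of_tendsto hclt' (by fun_prop)
      (fun z => (lt_min (Real.exp_pos _) (Real.exp_pos _)).le) (C := C) ?_ ?_ ?_ ?_
    · intro k
      obtain ⟨⟨h1, h2⟩, -⟩ := hN (k + N) (Nat.le_add_left N k)
      exact (min_exp_prod_facts (μs (k + N) : Measure ℝ) c (hexpn _ h1 h2 c hc1)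
        (hexpn _ h1 h2 (2 * c) le_rfl)).2.1
    · intro k
      obtain ⟨⟨h1, h2⟩, h3⟩ := hN (k + N) (Nat.le_add_left N k)
      refine (min_exp_prod_facts (μs (k + N) : Measure ℝ) c (hexpn _ h1 h2 c hc1)
        (hexpn _ h1 h2 (2 * c) le_rfl)).2.2.trans ?_
      change ∫ u, Real.exp (2 * c * u) ∂((P (k + N)).map (S (k + N))) ≤ C
      rw [pi_integral_exp_mul_map_inv_sqrt_mul_sum hgm (k + N) (2 * c)]
      exact_mod_cast h3
    · exact (min_exp_prod_facts (μ : Measure ℝ) c (hexpG c) (hexpG (2 * c))).2.1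
    · refine (min_exp_prod_facts (μ : Measure ℝ) c (hexpG c) (hexpG (2 * c))).2.2.trans ?_
      change ∫ u, Real.exp (2 * c * u) ∂(gaussianReal 0 v.toNNReal) ≤ C
      have hm := mgf_gaussianReal (p := gaussianReal 0 v.toNNReal) (X := id) (μ := 0) (v := v.toNNReal)
        Measure.map_id (2 * c)
      simp only [mgf, id_eq] at hm
      rw [show (fun u : ℝ => Real.exp (2 * c * u)) = fun u => Real.exp ((2 * c) * u) from rfl, hm,
        Real.coe_toNNReal v hv0, hC, zero_mul, zero_add]
      have e2 : ∀ a b : ℝ, a = b → Real.exp a ≤ Real.exp b + 1 := fun a b h => by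
        rw [h]; linarith [Real.exp_pos b]
      exact e2 _ _ (by ring)
  -- (5) the denominator
  have hden : Tendsto (fun n : ℕ => ∫ x, Real.exp (c / Real.sqrt n * ∑ i, g (x i)) ∂(P n)) atTop
      (𝓝 (Real.exp (c ^ 2 * v / 2))) := by
    refine (tendsto_mgf_div_sqrt_pow_of_mem_interior h0int h0 c).congr fun n => ?_
    rw [pi_integral_exp_mul_sum hgm n]
  -- (6) assemble along the shifted sequence, then shift back
  have hnum' : Tendsto (fun k : ℕ => ∫ x, ∫ y, min (Real.exp (c / Real.sqrt ↑(k + N) * ∑ i, g (x i)))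
        (Real.exp (c / Real.sqrt ↑(k + N) * ∑ i, g (y i))) ∂(P (k + N)) ∂(P (k + N))) atTop
      (𝓝 (∫ z, min (Real.exp (c * z.1)) (Real.exp (c * z.2)) ∂((μ : Measure ℝ).prod μ))) := by
    refine hnum.congr fun k => ?_
    obtain ⟨⟨h1, h2⟩, -⟩ := hN (k + N) (Nat.le_add_left N k)
    have hc1 : |c| ≤ |2 * c| := by rw [abs_mul, abs_two]; linarith [abs_nonneg c]
    have e : ∀ x : Fin (k + N) → X, c / Real.sqrt ↑(k + N) * ∑ i, g (x i) = c * S (k + N) x :=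
      fun x => by simp only [hS]; ring
    simp_rw [e]
    exact (integral_integral_min_exp_eq_integral_prod_map (P (k + N)) (hSm (k + N)) c
      (hexpn _ h1 h2 c hc1) (hexpn _ h1 h2 (2 * c) le_rfl)).symm
  have hden' := hden.comp (tendsto_add_atTop_nat N)
  have hlim' := hnum'.div hden' (Real.exp_pos _).ne'
  have hlim : Tendsto (fun n : ℕ =>
        (∫ x, ∫ y, min (Real.exp (c / Real.sqrt n * ∑ i, g (x i)))
              (Real.exp (c / Real.sqrt n * ∑ i, g (y i))) ∂(P n) ∂(P n))
          / ∫ x, Real.exp (c / Real.sqrt n * ∑ i, g (x i)) ∂(P n)) atTop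
      (𝓝 ((∫ z, min (Real.exp (c * z.1)) (Real.exp (c * z.2)) ∂((μ : Measure ℝ).prod μ))
        / Real.exp (c ^ 2 * v / 2))) := by
    rw [← tendsto_add_atTop_iff_nat N]
    exact hlim'
  -- (7) identify the limit with the log-normal acceptance law (as in the bounded case)
  have hprodA : ∫ z, min (Real.exp (c * z.1)) (Real.exp (c * z.2)) ∂((μ : Measure ℝ).prod μ)
      = ∫ x, ∫ y, min (Real.exp (c * x)) (Real.exp (c * y)) ∂(gaussianReal 0 v.toNNReal)
          ∂(gaussianReal 0 v.toNNReal) :=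
    integral_prod _ (min_exp_prod_facts (μ : Measure ℝ) c (hexpG c) (hexpG (2 * c))).1
  rw [hprodA] at hlim
  set s : ℝ≥0 := (c ^ 2 * v).toNNReal with hs
  have hcv : 0 ≤ c ^ 2 * v := by positivity
  have hsR : (s : ℝ) = c ^ 2 * v := Real.coe_toNNReal _ hcv
  have hφ : noiseLaw s
      = (gaussianReal 0 v.toNNReal).map (fun u => c * u + (-(c ^ 2 * v / 2))) := by
    rw [show (fun u : ℝ => c * u + (-(c ^ 2 * v / 2))) = (fun u => u + (-(c ^ 2 * v / 2))) ∘ (fun u => c * u)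
        from rfl,
      ← Measure.map_map (measurable_add_const _) (measurable_const_mul c), gaussianReal_map_const_mul,
      gaussianReal_map_add_const, noiseLaw, hsR]
    congr 1
    · ring
    · ext
      push_cast
      rw [Real.coe_toNNReal _ hcv, Real.coe_toNNReal _ hv0]
  have hF2c : Continuous fun z : ℝ × ℝ => min (Real.exp z.1) (Real.exp z.2) := by fun_prop
  have hEq : (∫ x, ∫ y, min (Real.exp (c * x)) (Real.exp (c * y)) ∂(gaussianReal 0 v.toNNReal)
        ∂(gaussianReal 0 v.toNNReal)) / Real.exp (c ^ 2 * v / 2)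
      = ∫ x, ∫ y, min (Real.exp x) (Real.exp y) ∂(noiseLaw s) ∂(noiseLaw s) := by
    rw [hφ, integral_map (by fun_prop)
      (hF2c.stronglyMeasurable.integral_prod_right').aestronglyMeasurable]
    have inner : ∀ x : ℝ, ∫ y, min (Real.exp x) (Real.exp y)
          ∂((gaussianReal 0 v.toNNReal).map (fun u => c * u + (-(c ^ 2 * v / 2))))
        = ∫ u, min (Real.exp x) (Real.exp (c * u + (-(c ^ 2 * v / 2)))) ∂(gaussianReal 0 v.toNNReal) :=
      fun x => integral_map (by fun_prop) (by fun_prop)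
    simp_rw [inner]
    have pt : ∀ u u' : ℝ, min (Real.exp (c * u + (-(c ^ 2 * v / 2)))) (Real.exp (c * u' + (-(c ^ 2 * v / 2))))
        = min (Real.exp (c * u)) (Real.exp (c * u')) * Real.exp (-(c ^ 2 * v / 2)) := fun u u' => by
      rw [Real.exp_add, Real.exp_add, min_mul_of_nonneg _ _ (Real.exp_pos _).le]
    simp_rw [pt, integral_mul_const]
    rw [Real.exp_neg, div_eq_mul_inv]
  rw [hEq] at hlim
  exact hlim

/-- **THE PROFILE IS `erfc(|c|σ/2)`** for unbounded statistics too (`c ≠ 0`, `Var g ≠ 0`). [ours] -/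
theorem tiltPi_meanAccept_diag_tendsto_erfc_of_mem_interior (hgm : Measurable g)
    (h0int : (0 : ℝ) ∈ interior (integrableExpSet g ν)) (h0 : ∫ x, g x ∂ν = 0) {c : ℝ} (hc : c ≠ 0)
    (hσ : Var[g; ν] ≠ 0) :
    Tendsto (fun n : ℕ =>
        (∫ x, ∫ y, min (Real.exp (c / Real.sqrt n * ∑ i, g (x i)))
              (Real.exp (c / Real.sqrt n * ∑ i, g (y i)))
            ∂(Measure.pi fun _ : Fin n => ν) ∂(Measure.pi fun _ : Fin n => ν))
          / ∫ x, Real.exp (c / Real.sqrt n * ∑ i, g (x i)) ∂(Measure.pi fun _ : Fin n => ν))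
      atTop (𝓝 (2 / Real.sqrt Real.pi
        * ∫ u in Ioi (Real.sqrt (c ^ 2 * Var[g; ν]) / 2), Real.exp (-u ^ 2))) := by
  have hpos : 0 < c ^ 2 * Var[g; ν] :=
    mul_pos (by positivity) (lt_of_le_of_ne (variance_nonneg _ _) (Ne.symm hσ))
  have hs : (c ^ 2 * Var[g; ν]).toNNReal ≠ 0 := fun h =>
    absurd (Real.toNNReal_eq_zero.1 h) (not_le.2 hpos)
  have h := tiltPi_meanAccept_diag_tendsto_of_mem_interior hgm h0int h0 c
  rw [Scoring.imh_lognormal_accRate_eq_erfc hs, Real.coe_toNNReal _ hpos.le] at h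
  exact h

end Subexp

end Summit.Ventures.LatticeQCDFlow.Theory2

end
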